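import Summits.ABC.IUTFork.Joshi.ThetaLocusSaturation
import Summits.ABC.IUTFork.Joshi.ThetaValuesLocusModelPadic
import HarnessLib

/-!
# A kernel MODEL of the E-t3 carriers `PeriodRingDatum` / `PrototypeDatum` / `CanonicalPoint` / `RootTower` over `Q̄_p = PadicAlgCl p`
# — the VACUITY CHECK of branch E's typing of Joshi arXiv:2303.01662 (O1, E-plan-2 ruling 2026-08-26T07:28:52Z)

Test-side support file of the abc-iut cell, branch E (rung LADDER-ABC:A2.E; seat abc-iut-E-t3). PURPOSE: the hypothesis structures of
`Joshi/ThetaValuesLocus.lean` (p427971), `Joshi/PrimitiveAnsatz.lean` (p428639), `Joshi/ThetaLocusPrototype.lean` (p429136) and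
`Joshi/ThetaLocusSaturation.lean` (p430929) are INSTANTIATED in the kernel, so that the theorems proved over them (Thm. 6.9.1, Lem. 8.4.1,
Prop. 9.4.1, Thm. 9.2.1 `prototypeBound`, the saturation `one_le_size_thetaLocus`, …) are statements about a NONEMPTY class of structures
(refuters' vacuity smell, CONVENTIONS §4). The model is LOGICAL, not arithmetic-faithful: it realises the signature's axioms ((A1)
`|η_y([x])|_{K_y} = |x|_F`, (A2) lifts of the unit ball, (A3) `|ι_y(z)|_{K_y} = |z|_0^{scale y}`, (A4) `|p|_{K_{y_a}} = |a|_F`, ultrametric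
norms, Galois/Frobenius stability, …) with `F = Y = E0 = K_y := Q̄_p` (so the "tilt" has characteristic `0` here — the signature does not
record `char F = p`), `B := (Q̄_p → Q̄_p)` with `η_a` = evaluation at `a`, trivial Galois, `φ = id` on `B`, `φ(y) = y^p` on points,
`T_y = {0}`, the residue-field absolute value at `a ∈ 𝔪 ∖ 0` TWISTED to `‖·‖^{e_a}`, `e_a = log‖a‖ / log‖p‖` (so that `‖p‖^{e_a} = ‖a‖`),
and the Teichmüller/untilt map `x ↦ x · c_a(‖x‖)` a sphere-wise rescaling with `‖c_a(ρ)‖ = ρ^{1/e_a − 1}` (elements of every rational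
norm exponent exist in `Q̄_p`, `Model.exists_norm_eq_norm_rpow`). Canonical point `t = p`, `a = p^{1/4}`; root
tower `t^{1/N} := ` an `N`-th root of `p` (`ℓ⋆ = 2`, `q_E := p^{10}`, `ξ := p`). NOTHING here is a claim about Joshi's or Mochizuki's mathematics; it shows only that the typed
axioms are jointly satisfiable. [folklore]
-/

noncomputable section

open Set

namespace Summit.ABC.IUTFork.Joshi.Model

open PadicAlgCl

variable (p : ℕ) [hp : Fact p.Prime]

/-- Local copy: `‖p‖ = p⁻¹` in `Q̄_p`. [folklore] -/
private theorem norm_p' : ‖(p : PadicAlgCl p)‖ = (p : ℝ)⁻¹ := by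
  rw [← map_natCast (algebraMap ℚ_[p] (PadicAlgCl p)), ← PadicAlgCl.coe_eq]
  show ‖((p : ℚ_[p]) : PadicAlgCl p)‖ = _
  rw [PadicAlgCl.norm_extends, Padic.norm_p]

/-- Local copy: `0 < ‖p‖ < 1`. [folklore] -/
private theorem norm_p_pos_lt_one' : 0 < ‖(p : PadicAlgCl p)‖ ∧ ‖(p : PadicAlgCl p)‖ < 1 := by
  have h1 : (1 : ℝ) < p := by exact_mod_cast hp.out.one_lt
  rw [norm_p']
  exact ⟨inv_pos.2 (lt_trans one_pos h1), inv_lt_one_of_one_lt₀ h1⟩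

/-- Local copy: `(p : Q̄_p) ≠ 0`. [folklore] -/
private theorem p_ne_zero' : (p : PadicAlgCl p) ≠ 0 := by exact_mod_cast hp.out.ne_zero

/-! ## 1. The twisting exponent `e_a` and the rescaling constants -/

/-- The twisting exponent of the point `a`: `e_a = log‖a‖ / log‖p‖` for `0 < ‖a‖ < 1` (so that `‖p‖^{e_a} = ‖a‖`), else `1`. [folklore] -/
def expo (a : PadicAlgCl p) : ℝ :=
  if 0 < ‖a‖ ∧ ‖a‖ < 1 then Real.log ‖a‖ / Real.log ‖(p : PadicAlgCl p)‖ else 1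

/-- `e_a > 0`. [folklore] -/
theorem expo_pos (a : PadicAlgCl p) : 0 < expo p a := by
  unfold expo
  split_ifs with h
  · exact div_pos_of_neg_of_neg (Real.log_neg h.1 h.2) (Real.log_neg (norm_p_pos_lt_one' p).1 (norm_p_pos_lt_one' p).2)
  · exact one_pos

/-- `‖p‖^{e_a} = ‖a‖` for `0 < ‖a‖ < 1` (axiom (A4)). [folklore] -/
theorem norm_p_rpow_expo {a : PadicAlgCl p} (h0 : 0 < ‖a‖) (h1 : ‖a‖ < 1) :
    ‖(p : PadicAlgCl p)‖ ^ expo p a = ‖a‖ := by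
  unfold expo
  rw [if_pos ⟨h0, h1⟩, Real.rpow_def_of_pos (norm_p_pos_lt_one' p).1,
    mul_div_cancel₀ _ (Real.log_neg (norm_p_pos_lt_one' p).1 (norm_p_pos_lt_one' p).2).ne, Real.exp_log h0]

/-- `e_a` is rational: `−normExp a` on `𝔪 ∖ 0`, `1` elsewhere. [folklore] -/
theorem expo_rat (a : PadicAlgCl p) : ∃ r : ℚ, expo p a = (r : ℝ) := by
  unfold expo
  split_ifs with h
  · have ha : a ≠ 0 := norm_pos_iff.1 h.1
    refine ⟨-normExp p a, ?_⟩
    rw [log_norm p ha, log_norm_p]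
    have := log_p_pos p
    push_cast
    field_simp
  · exact ⟨1, by simp⟩

/-- The rescaling exponent `1/e_a − 1` is rational. [folklore] -/
theorem rescale_rat (a : PadicAlgCl p) : ∃ r : ℚ, 1 / expo p a - 1 = (r : ℝ) := by
  obtain ⟨r, hr⟩ := expo_rat p a
  exact ⟨1 / r - 1, by rw [hr]; push_cast; ring⟩

open scoped Classical in
/-- The rescaling constant `c_a(ρ)`: a nonzero element of norm `ρ^{1/e_a − 1}` when one exists, else `1`. [folklore] -/
def cfun (a : PadicAlgCl p) (ρ : ℝ) : PadicAlgCl p :=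
  if h : ∃ c : PadicAlgCl p, c ≠ 0 ∧ ‖c‖ = ρ ^ (1 / expo p a - 1) then h.choose else 1

/-- For `ρ = ‖x‖`, `x ≠ 0`, the constant exists: `c_a(‖x‖) ≠ 0` and `‖c_a(‖x‖)‖ = ‖x‖^{1/e_a − 1}`. [folklore] -/
theorem cfun_spec (a : PadicAlgCl p) {x : PadicAlgCl p} (hx : x ≠ 0) :
    cfun p a ‖x‖ ≠ 0 ∧ ‖cfun p a ‖x‖‖ = ‖x‖ ^ (1 / expo p a - 1) := by
  obtain ⟨r, hr⟩ := rescale_rat p a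
  have h : ∃ c : PadicAlgCl p, c ≠ 0 ∧ ‖c‖ = ‖x‖ ^ (1 / expo p a - 1) := by
    rw [hr]; exact exists_norm_eq_norm_rpow p hx r
  unfold cfun
  rw [dif_pos h]
  exact h.choose_spec

/-- The untilt/Teichmüller map at the point `a`: `x ↦ x · c_a(‖x‖)`. [folklore] -/
def lift (a x : PadicAlgCl p) : PadicAlgCl p := x * cfun p a ‖x‖

/-- `‖lift a x‖ = ‖x‖^{1/e_a}`. [folklore] -/
theorem norm_lift (a x : PadicAlgCl p) : ‖lift p a x‖ = ‖x‖ ^ (1 / expo p a) := by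
  unfold lift
  by_cases hx : x = 0
  · rw [hx, zero_mul, norm_zero, Real.zero_rpow (one_div_pos.2 (expo_pos p a)).ne']
  · rw [norm_mul, (cfun_spec p a hx).2]
    have hxpos : 0 < ‖x‖ := norm_pos_iff.2 hx
    calc ‖x‖ * ‖x‖ ^ (1 / expo p a - 1) = ‖x‖ ^ (1 : ℝ) * ‖x‖ ^ (1 / expo p a - 1) := by rw [Real.rpow_one]
      _ = ‖x‖ ^ (1 + (1 / expo p a - 1)) := (Real.rpow_add hxpos _ _).symm
      _ = ‖x‖ ^ (1 / expo p a) := by ring_nf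

/-- Axiom (A1): `‖lift a x‖^{e_a} = ‖x‖`. [folklore] -/
theorem norm_lift_rpow (a x : PadicAlgCl p) : ‖lift p a x‖ ^ expo p a = ‖x‖ := by
  rw [norm_lift, ← Real.rpow_mul (norm_nonneg x), one_div_mul_cancel (expo_pos p a).ne', Real.rpow_one]

/-- Axiom (A2): `lift a` is onto. [folklore] -/
theorem lift_surjective (a ξ : PadicAlgCl p) : ∃ x : PadicAlgCl p, lift p a x = ξ := by
  by_cases hξ : ξ = 0
  · exact ⟨0, by rw [hξ]; unfold lift; rw [zero_mul]⟩
  · -- the sphere of radius `ρ = ‖ξ‖^{e_a}` maps onto the sphere of `ξ`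
    obtain ⟨r, hr⟩ := expo_rat p a
    obtain ⟨x₀, hx₀, hx₀n⟩ := exists_norm_eq_norm_rpow p hξ r
    have hρ : ‖x₀‖ = ‖ξ‖ ^ expo p a := by rw [hx₀n, hr]
    obtain ⟨hc0, hcn⟩ := cfun_spec p a hx₀
    refine ⟨ξ / cfun p a ‖x₀‖, ?_⟩
    have hξpos : 0 < ‖ξ‖ := norm_pos_iff.2 hξ
    have he : expo p a ≠ 0 := (expo_pos p a).ne'
    have hn : ‖ξ / cfun p a ‖x₀‖‖ = ‖x₀‖ := by
      rw [norm_div, hcn, hρ, ← Real.rpow_mul hξpos.le, div_eq_iff (Real.rpow_pos_of_pos hξpos _).ne',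
        ← Real.rpow_add hξpos]
      conv_lhs => rw [← Real.rpow_one ‖ξ‖]
      congr 1
      field_simp
      ring
    unfold lift
    rw [hn, div_mul_cancel₀ _ hc0]

/-! ## 2. The model of `PeriodRingDatum` -/

/-- **The model period-ring datum over `Q̄_p`** (see the module docstring for the dictionary of choices). [folklore] -/
def periodRingDatum : PeriodRingDatum (PadicAlgCl p) (PadicAlgCl p → PadicAlgCl p) (PadicAlgCl p) (PadicAlgCl p)
    (fun _ => PadicAlgCl p) Unit where
  p := p
  p_prime := hp.out
  absF := absOne p
  norm _ f := ‖f (p : PadicAlgCl p)‖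
  norm_nonneg _ f := norm_nonneg _
  norm_add_le _ f g := PadicAlgCl.isNonarchimedean p _ _
  teich x := fun a => lift p a x
  norm_teich ρ x _ _ := by
    show ‖lift p (p : PadicAlgCl p) x‖ = absOne p x
    rw [absOne_apply, norm_lift]
    have : expo p (p : PadicAlgCl p) = 1 := by
      unfold expo; rw [if_pos (norm_p_pos_lt_one' p), div_self (Real.log_neg (norm_p_pos_lt_one' p).1
        (norm_p_pos_lt_one' p).2).ne]
    rw [this, div_one, Real.rpow_one]
  gal _ := id
  frob := id
  gal_norm_one _ _ h := h
  frob_norm_one _ h := h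
  absK a := absPow p (expo p a) (expo_pos p a)
  eta a := Pi.evalRingHom (fun _ : PadicAlgCl p => PadicAlgCl p) a
  absK_eta_teich a x := by
    show ‖lift p a x‖ ^ expo p a = ‖x‖ ^ (1 : ℝ)
    rw [Real.rpow_one]; exact norm_lift_rpow p a x
  exists_teich_lift a ξ _ := lift_surjective p a ξ
  T _ := {0}
  zero_mem_T _ := rfl
  eta_T a τ hτ := by rw [Set.mem_singleton_iff.1 hτ]; rfl
  T_norm_one a τ hτ := by rw [Set.mem_singleton_iff.1 hτ]; simp
  pt := id
  frobY y := y ^ p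
  pt_frob _ := rfl
  galF _ := RingHom.id _
  absF_galF _ _ := rfl
  galY _ := id
  pt_gal _ _ := rfl
  abs0 := absOne p
  abs0_p := by rw [absOne_apply]; exact norm_p_pos_lt_one' p
  emb _ := RingHom.id _
  scale a := expo p a
  scale_pos a := expo_pos p a
  absK_emb a z := by
    show ‖z‖ ^ expo p a = (absOne p z) ^ expo p a
    rw [absOne_apply]
  absK_pt a ha0 ha1 := by
    show ‖(p : PadicAlgCl p)‖ ^ expo p a = absOne p a
    rw [absOne_apply] at ha1 ⊢
    exact norm_p_rpow_expo p (norm_pos_iff.2 ha0) ha1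

/-! ## 3. The model of `PrototypeDatum`, its canonical point and root tower -/

/-- An `N`-th root of `p` in `Q̄_p` (`N ≥ 1`; a choice). [folklore] -/
def rootP (N : ℕ) : PadicAlgCl p :=
  if hN : 0 < N then (IsAlgClosed.exists_pow_nat_eq (p : PadicAlgCl p) hN).choose else 1

/-- `(rootP N)^N = p` for `N ≥ 1`. [folklore] -/
theorem rootP_pow {N : ℕ} (hN : 0 < N) : rootP p N ^ N = (p : PadicAlgCl p) := by
  unfold rootP; rw [dif_pos hN]; exact (IsAlgClosed.exists_pow_nat_eq (p : PadicAlgCl p) hN).choose_spec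

/-- `‖rootP N‖ = ‖p‖^{1/N}`. [folklore] -/
theorem norm_rootP {N : ℕ} (hN : 0 < N) : ‖rootP p N‖ = ‖(p : PadicAlgCl p)‖ ^ (1 / (N : ℝ)) := by
  have h : ‖rootP p N‖ ^ N = ‖(p : PadicAlgCl p)‖ := by rw [← norm_pow, rootP_pow p hN]
  rw [← h, one_div, Real.pow_rpow_inv_natCast (norm_nonneg _) hN.ne']

/-- **The model prototype datum**: `ℓ⋆ = 2` (`ℓ = 5`, as in the cell's `toyIndex`), `q_E := p^{10}`, `ξ := p` (so `|ξ|_0 = |q|_0^{1/(2ℓ)} =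
|q|_0^{1/10}`). [folklore] -/
def prototypeDatum : PrototypeDatum (PadicAlgCl p) (PadicAlgCl p → PadicAlgCl p) (PadicAlgCl p) (PadicAlgCl p)
    (fun _ => PadicAlgCl p) Unit where
  toPeriodRingDatum := periodRingDatum p
  lstar := 2
  one_le_lstar := by norm_num
  q := (p : PadicAlgCl p) ^ 10
  abs0_q := by
    show 0 < absOne p _ ∧ absOne p _ < 1
    rw [absOne_apply, norm_pow]
    exact ⟨pow_pos (norm_p_pos_lt_one' p).1 _, pow_lt_one₀ (norm_nonneg _) (norm_p_pos_lt_one' p).2 (by norm_num)⟩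
  xi := p
  abs0_xi := by
    show absOne p (p : PadicAlgCl p) = (absOne p ((p : PadicAlgCl p) ^ 10)) ^ (1 / (2 * ((2 * 2 + 1 : ℕ) : ℝ)))
    rw [absOne_apply, absOne_apply, norm_pow]
    have h : (1 / (2 * ((2 * 2 + 1 : ℕ) : ℝ))) = ((10 : ℕ) : ℝ)⁻¹ := by norm_num
    rw [h, Real.pow_rpow_inv_natCast (norm_nonneg _) (by norm_num)]

/-- `e_p = 1`: the base point `p` carries the untwisted absolute value. [folklore] -/
theorem expo_p : expo p (p : PadicAlgCl p) = 1 := by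
  unfold expo
  rw [if_pos (norm_p_pos_lt_one' p), div_self (Real.log_neg (norm_p_pos_lt_one' p).1 (norm_p_pos_lt_one' p).2).ne]

/-- **The model canonical point**: `t = p`, `a = p^{1/4}` (`scale (pt p) = e_p = 1`, `a^{ℓ⋆²} = a⁴ = p`). [folklore] -/
def canonicalPoint : (prototypeDatum p).CanonicalPoint where
  t := p
  t_ne_zero := p_ne_zero' p
  absF_t_lt_one := by show absOne p _ < 1; rw [absOne_apply]; exact (norm_p_pos_lt_one' p).2
  scale_pt_t := expo_p p
  a := rootP p 4
  a_pow := by show rootP p 4 ^ (2 ^ 2) = (p : PadicAlgCl p); exact rootP_pow p (by norm_num)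

/-- **The model root tower**: `t = p`, `t^{1/N} := rootP N`. [folklore] -/
def rootTower : (prototypeDatum p).RootTower where
  t := p
  t_ne_zero := p_ne_zero' p
  absF_t_lt_one := by show absOne p _ < 1; rw [absOne_apply]; exact (norm_p_pos_lt_one' p).2
  scale_pt_t := (canonicalPoint p).scale_pt_t
  root := rootP p
  root_pow N hN := rootP_pow p hN

/-! ## 4. Non-vacuity, packaged -/

/-- **NON-VACUITY of the E-t3 carriers**: the period-ring signature, the prototype datum, the canonical-point datum of Thm. 9.2.1 and the
root tower are simultaneously INSTANTIATED (over `Q̄_2`). [folklore] -/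
theorem carriers_nonempty :
    ∃ (P : PrototypeDatum (PadicAlgCl 2) (PadicAlgCl 2 → PadicAlgCl 2) (PadicAlgCl 2) (PadicAlgCl 2) (fun _ => PadicAlgCl 2) Unit),
      Nonempty P.CanonicalPoint ∧ Nonempty P.RootTower :=
  haveI : Fact (Nat.Prime 2) := ⟨Nat.prime_two⟩
  ⟨prototypeDatum 2, ⟨canonicalPoint 2⟩, ⟨rootTower 2⟩⟩

/-- Hence the typed theorems are about a nonempty class: e.g. Thm. 9.2.1 (`prototypeBound`) and the saturation `|Θ̃|_B ≥ 1`
(`one_le_size_thetaLocus`) hold IN THE MODEL. [folklore] -/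
theorem model_prototypeBound_and_saturation :
    ((((prototypeDatum p).abs0 (prototypeDatum p).xi) ^ (prototypeDatum p).lstar : ℝ) : EReal) ≤
        (prototypeDatum p).size (prototypeDatum p).thetaLocus ∧
      (1 : EReal) ≤ (prototypeDatum p).size (prototypeDatum p).thetaLocus :=
  ⟨(prototypeDatum p).prototypeBound (canonicalPoint p), (rootTower p).one_le_size_thetaLocus⟩

end Summit.ABC.IUTFork.Joshi.Model

end
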